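import Literature.NumberTheory.EllipticCurves.ModularSymbols
import Mathlib.Analysis.SpecialFunctions.ImproperIntegrals
import Mathlib.MeasureTheory.Function.JacobianOneDim
import Mathlib.Analysis.Calculus.SmoothSeries
import Mathlib.MeasureTheory.Integral.DominatedConvergence
import Mathlib.NumberTheory.ModularForms.QExpansion
import Mathlib.NumberTheory.Modular

/-!
# Modular symbols: the Manin calculus, proved (`ModularSymbols`, discharges)

This file discharges, sorry-free, the "Manin calculus" named facts of
`Literature.NumberTheory.EllipticCurves.ModularSymbols` for a weight-`2` cusp form
`f ∈ S₂(Γ₀(N))`: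

| named fact (`def … : Prop`)              | discharge                                      |
|------------------------------------------|------------------------------------------------|
| `integrableOn_eichlerIntegral_integrand` | `integrableOn_eichlerIntegral_integrand_holds` |
| `integrableOn_modularSymbol_integrand`   | `integrableOn_modularSymbol_integrand_holds`   |
| `modularSymbol_add_intCast`              | `modularSymbol_add_intCast_holds`              |
| `eichlerIntegral_smul_sub`               | `eichlerIntegral_smul_sub_holds`               |
| `cuspSymbol_mul` (Manin's homomorphism)  | `cuspSymbol_mul_holds`                         |
| `eichlerIntegral_gamma_smul`             | `eichlerIntegral_gamma_smul_holds`             |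
| `modularSymbol_gamma0_smul` (Manin rel.) | `modularSymbol_gamma0_smul_holds`              |

together with the `q`-expansion of the Eichler integral (`hasSum_eichlerIntegral`:
`2πi ∫_{i∞}^τ f = ∑ (aₙ/n) qⁿ`), its holomorphy (`hasDerivAt_eichlerIntegral`:
`d/dz = 2πi f`), and the general `SL(2, ℤ)` formula
`{∞, γ∞}_f = V_f(γτ) - V_{f|γ}(τ)` (`modularSymbol_smul_infty`), and the linearity of
`h ↦ {∞, r}_h`, `h ↦ {∞, γ∞}_h` in the form (`modularSymbol_add`, `modularSymbol_const_smul`,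
`cuspSymbol_add`, `cuspSymbol_smul`).

## The argument (no two-dimensional Cauchy theorem is needed)

Recall `{∞, r}_f = 2π ∫₀^∞ f(r + it) dt` and `V_φ(τ) := 2π ∫₀^∞ φ(τ + it) dt = 2πi ∫_{i∞}^τ φ`
(`verticalIntegral`; `eichlerIntegral f = verticalIntegral ⇑f`).

1. (`IsCuspFunction.hasSum_verticalIntegral`, `.hasDerivAt_verticalIntegral`) For a *cuspidal
   `q`-series function* `φ` of period `h` (holomorphic on `ℍ`, `φ ∘ ofComplex` `h`-periodic,
   `φ → 0` at `i∞`; e.g. `f ∣[k] g`, `g ∈ SL(2, ℤ)`, `h = N`), Mathlib's `hasSum_qExpansion`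
   gives `φ = ∑_{n ≥ 1} cₙ q_hⁿ` with `∑ |cₙ| ρⁿ < ∞` for `ρ < 1`; integrating termwise along the
   ray, `V_φ(τ) = ∑ cₙ (h/n) q_h(τ)ⁿ`, and differentiating termwise, `V_φ' = 2πi φ` on `ℍ`;
   also `|φ(τ + it)| ≪_τ e^{-2πt/h}`, whence integrability along rays.
2. (`verticalIntegral_smul_sub_eq`) By the chain rule and `(φ ∣[2] g)(z) = φ(gz)(cz + d)⁻²`,
   `z ↦ V_φ(gz) - V_{φ|g}(z)` has derivative `0` on the (connected) upper half-plane, hence is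
   constant (Manin 1972, Prop. 1.4: `{τ, gτ}` is independent of `τ`).
3. (`modularSymbol_smul_infty`) **`γ` maps the vertical ray above `γ⁻¹∞ = -d/c` onto the vertical
   ray above `γ∞ = a/c`**: `γ(-d/c + iu) = a/c + i/(c²u)`. Splitting `∫₀^∞ f(a/c + it) dt` at
   `t = 1/|c|`, the tail is `V_f(γw₀)/2π` with `w₀ = -d/c + i/|c|`, and the one-dimensional
   substitution `t = 1/(c²u)` turns the head into `-V_{f|γ}(w₀)/2π` (weight `2`:
   `f(a/c + it) dt = -(f ∣[2] γ)(-d/c + iu) du`). Hence `{∞, a/c}_f = V_f(γτ) - V_{f|γ}(τ)`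
   for all `τ`, and `t ↦ f(a/c + it)` is integrable at `0⁺` because `f ∣[2] γ` is cuspidal at
   `∞` (every rational `r` is `δ_r ∞`, `δ_r ∈ SL(2, ℤ)`, `cuspMatrix`).
4. For `γ ∈ Γ₀(N)`, `f ∣[2] γ = f`, so `{∞, γ∞}_f = V_f(γτ) - V_f(τ)`
   (`eichlerIntegral_smul_sub_holds`); Manin's homomorphism property and the relation
   `{∞, γr} = {∞, γ∞} + {∞, r}` (apply 3 to `γ δ_r`) follow by telescoping.

Not treated here: `{∞, 0}_f = L(f, 1)` (`modularSymbol_zero_eq`, needs the entire continuation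
of `L(f, s)`), Manin–Drinfeld, Eichler–Shimura (`isZLattice_periodLattice`) and Birch's formula.

## References

* Ju. I. Manin, *Parabolic points and zeta functions of modular curves*, Izv. Akad. Nauk SSSR
  36 (1972), 19–66: §1.2, Prop. 1.4, §1.5–1.6, Thm. 1.6.
* J. E. Cremona, *Algorithms for modular elliptic curves*, 2nd ed., CUP 1997: §2.1
  (Prop. 2.1.1), §2.2, §2.10 ((2.10.1)–(2.10.3): `q`-expansion of the period integral).
-/

noncomputable section

open scoped MatrixGroups ModularForm Topology Manifold

open CongruenceSubgroup Complex MeasureTheory Set Filter Function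
open UpperHalfPlane hiding I

namespace Literature.NumberTheory.EllipticCurves.ModularForms

/-- The **vertical-ray integral** `V_φ(τ) = 2π ∫₀^∞ φ(τ + it) dt = 2πi ∫_{i∞}^{τ} φ(z) dz` of a
function on `ℍ`; `eichlerIntegral f = verticalIntegral ⇑f` by `rfl`. [folklore] -/
def verticalIntegral (φ : ℍ → ℂ) (τ : ℍ) : ℂ :=
  2 * Real.pi * ∫ t in Ioi (0 : ℝ), φ (ofComplex ((τ : ℂ) + t * Complex.I))

/-- A **cuspidal `q`-series function** of period `h > 0` on `ℍ`: `φ ∘ ofComplex` is `h`-periodic,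
`φ` is holomorphic and tends to `0` at `i∞`; e.g. `⇑f ∣[k] g` for a cusp form `f` on `Γ₀(N)` and
`g ∈ SL(2, ℤ)` (`h = N`). Such a `φ` equals its `q`-expansion `∑_{n ≥ 1} cₙ e^{2πinτ/h}`
(Mathlib `hasSum_qExpansion`). [folklore] -/
structure IsCuspFunction (h : ℝ) (φ : ℍ → ℂ) : Prop where
  pos : 0 < h
  periodic : Periodic (φ ∘ ofComplex) h
  mdifferentiable : MDifferentiable 𝓘(ℂ) 𝓘(ℂ) φ
  isZeroAtImInfty : IsZeroAtImInfty φ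

namespace IsCuspFunction

variable {h : ℝ} {φ : ℍ → ℂ} (hφ : IsCuspFunction h φ)
include hφ

/-- A cuspidal `q`-series function is bounded at `i∞`. [folklore] -/
theorem isBoundedAtImInfty : IsBoundedAtImInfty φ :=
  hφ.isZeroAtImInfty.boundedAtFilter

/-- `φ(τ) = ∑ₙ cₙ q_h(τ)ⁿ` on `ℍ` (Mathlib `hasSum_qExpansion`). [folklore] -/
theorem hasSum (τ : ℍ) :
    HasSum (fun n : ℕ ↦ (qExpansion h φ).coeff n * Periodic.qParam h τ ^ n) (φ τ) := by
  simpa [smul_eq_mul] using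
    hasSum_qExpansion hφ.pos hφ.periodic hφ.mdifferentiable hφ.isBoundedAtImInfty τ

/-- `c₀ = 0` since `φ → 0` at `i∞`. [folklore] -/
theorem coeff_zero : (qExpansion h φ).coeff 0 = 0 := by
  simp [qExpansion_coeff, hφ.isZeroAtImInfty.cuspFunction_apply_zero hφ.pos]

/-- **Absolute convergence of the `q`-expansion inside the unit disc**: `∑ |cₙ| rⁿ < ∞` for
`0 ≤ r < 1` (the `q`-series converges at `q = (1 + r)/2`, so its radius exceeds `r`). [folklore] -/
theorem summable_norm_coeff_mul_pow {r : ℝ} (hr0 : 0 ≤ r) (hr : r < 1) :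
    Summable fun n : ℕ ↦ ‖(qExpansion h φ).coeff n‖ * r ^ n := by
  -- the `q`-series converges at `q = r' := (r + 1) / 2`, so its radius is `≥ r' > r`
  set p : FormalMultilinearSeries ℂ ℂ ℂ :=
    FormalMultilinearSeries.ofScalars ℂ fun n ↦ (qExpansion h φ).coeff n
  have hp : ∀ n, ‖p n‖ = ‖(qExpansion h φ).coeff n‖ := fun n ↦
    FormalMultilinearSeries.ofScalars_norm _ _ _
  lift r to NNReal using hr0
  set r' : NNReal := (r + 1) / 2
  have hr1 : (r : ℝ) < 1 := by exact_mod_cast hr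
  have hr' : (r : ℝ) < r' := by simp only [r', NNReal.coe_div, NNReal.coe_add]; norm_num; linarith
  have hr'1 : (r' : ℝ) < 1 := by simp only [r', NNReal.coe_div, NNReal.coe_add]; norm_num; linarith
  have hsum := hasSum_qExpansion_of_norm_lt (q := (r' : ℂ)) hφ.pos hφ.periodic hφ.mdifferentiable
    hφ.isBoundedAtImInfty (by simpa using hr'1)
  have ht : Tendsto (fun n ↦ ‖p n‖ * (r' : ℝ) ^ n) atTop (𝓝 0) := by
    have := hsum.summable.tendsto_atTop_zero.norm
    simp only [norm_zero] at this
    convert this using 2 with n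
    simp [hp, norm_pow]
  have hrad : ((r : NNReal) : ENNReal) < p.radius :=
    lt_of_lt_of_le (by exact_mod_cast hr') (p.le_radius_of_tendsto ht)
  simpa [hp] using p.summable_norm_mul_pow hrad

/-- `φ ∘ ofComplex` is continuous on the upper half-plane. [folklore] -/
theorem continuousOn_comp_ofComplex : ContinuousOn (φ ∘ ofComplex) {z : ℂ | 0 < z.im} :=
  (UpperHalfPlane.mdifferentiable_iff.mp hφ.mdifferentiable).continuousOn

omit hφ in
/-- `q_h(z + it)ⁿ = q_h(z)ⁿ · e^{-2πnt/h}`. [folklore] -/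
theorem qParam_add_mul_I_pow (h : ℝ) (z : ℂ) (t : ℝ) (n : ℕ) :
    Periodic.qParam h (z + t * I) ^ n =
      Periodic.qParam h z ^ n * (Real.exp (-(2 * Real.pi * n / h) * t) : ℂ) := by
  rw [Complex.ofReal_exp]
  simp only [Periodic.qParam, ← Complex.exp_nat_mul, ← Complex.exp_add]
  congr 1
  push_cast
  ring_nf
  rw [I_sq]
  ring

/-- On the vertical ray above `τ`, `φ(τ + it) = ∑ cₙ q_h(τ)ⁿ e^{-2πnt/h}` (`t > 0`). [folklore] -/
theorem hasSum_ray (τ : ℍ) {t : ℝ} (ht : 0 < t) :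
    HasSum (fun n : ℕ ↦ (qExpansion h φ).coeff n * (Periodic.qParam h τ ^ n *
      (Real.exp (-(2 * Real.pi * n / h) * t) : ℂ))) (φ (ofComplex ((τ : ℂ) + t * I))) := by
  have him : 0 < ((τ : ℂ) + t * I).im := by simpa using τ.im_pos.trans (by linarith)
  have := hφ.hasSum ⟨(τ : ℂ) + t * I, him⟩
  rw [ofComplex_apply_of_im_pos him]
  simpa only [UpperHalfPlane.coe_mk, qParam_add_mul_I_pow] using this

/-- The terms `|cₙ| ρⁿ e^{-2πnt/h}` are dominated by `|cₙ| ρⁿ e^{-2πt/h}` (`n ≥ 1`; `c₀ = 0`).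
[folklore] -/
theorem norm_rayTerm_le (τ : ℍ) {t : ℝ} (ht : 0 < t) (n : ℕ) :
    ‖(qExpansion h φ).coeff n * (Periodic.qParam h τ ^ n *
      (Real.exp (-(2 * Real.pi * n / h) * t) : ℂ))‖ ≤
      ‖(qExpansion h φ).coeff n‖ * ‖Periodic.qParam h τ‖ ^ n *
        Real.exp (-(2 * Real.pi / h) * t) := by
  have hh := hφ.pos
  rcases Nat.eq_zero_or_pos n with rfl | hn
  · simp [hφ.coeff_zero]
  · rw [norm_mul, norm_mul, norm_pow, Complex.norm_real, Real.norm_eq_abs, Real.abs_exp,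
      ← mul_assoc]
    refine mul_le_mul_of_nonneg_left (Real.exp_le_exp.mpr ?_) (by positivity)
    have h1 : (1 : ℝ) ≤ n := by exact_mod_cast hn
    have : 2 * Real.pi / h * t ≤ 2 * Real.pi * n / h * t := by
      rw [div_mul_eq_mul_div, div_mul_eq_mul_div]
      refine div_le_div_of_nonneg_right ?_ hh.le
      have h2 : 0 ≤ 2 * Real.pi * t := by positivity
      nlinarith
    rw [neg_mul, neg_mul, neg_le_neg_iff]
    exact this

/-- **Termwise integration of the `q`-expansion along a vertical ray**:
`∫₀^∞ φ(τ + it) dt = ∑ₙ cₙ q_h(τ)ⁿ · h/(2πn)` (absolutely convergent since `∑ |cₙ| ρⁿ < ∞` for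
`ρ = |q_h(τ)| < 1`) (Manin 1972, §1.5; Cremona 1997, §2.10, (2.10.2)). [cite: CremonaAlgorithms1997, §2.10] -/
theorem hasSum_integral_ray (τ : ℍ) :
    HasSum (fun n : ℕ ↦ (qExpansion h φ).coeff n * Periodic.qParam h τ ^ n *
        (h / (2 * Real.pi * n)))
      (∫ t in Ioi (0 : ℝ), φ (ofComplex ((τ : ℂ) + t * I))) := by
  have hh := hφ.pos
  set c : ℕ → ℂ := fun n ↦ (qExpansion h φ).coeff n with hc
  set q : ℂ := Periodic.qParam h τ
  set F : ℕ → ℝ → ℂ := fun n t ↦ c n * (q ^ n * (Real.exp (-(2 * Real.pi * n / h) * t) : ℂ))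
    with hF
  have hρ : ‖q‖ < 1 := Periodic.norm_qParam_lt_one hh τ.im_pos
  have ha : ∀ n : ℕ, 0 < n → (-(2 * Real.pi * n / h) : ℝ) < 0 := fun n hn ↦ by
    have : 0 < 2 * Real.pi * n / h := by positivity
    linarith
  have hc0 : c 0 = 0 := hφ.coeff_zero
  -- each term is a constant multiple of a real exponential
  have hFeq : ∀ n (t : ℝ), F n t = c n * q ^ n * (Real.exp (-(2 * Real.pi * n / h) * t) : ℂ) :=
    fun n t ↦ by simp only [hF, mul_assoc]
  -- integrability of each term
  have hint : ∀ n, Integrable (F n) (volume.restrict (Ioi 0)) := by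
    intro n
    rcases Nat.eq_zero_or_pos n with rfl | hn
    · simp [hF, hc0]
    · have : IntegrableOn (fun t : ℝ ↦ c n * q ^ n * (Real.exp (-(2 * Real.pi * n / h) * t) : ℂ))
          (Ioi 0) :=
        ((integrableOn_exp_mul_Ioi (ha n hn) 0).ofReal).const_mul (c n * q ^ n)
      exact IntegrableOn.congr_fun this (fun t _ ↦ (hFeq n t).symm) measurableSet_Ioi
  -- the integrals of the norms
  have hnorm : ∀ n, ∫ t in Ioi (0 : ℝ), ‖F n t‖ = ‖c n‖ * ‖q‖ ^ n * (h / (2 * Real.pi * n)) := by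
    intro n
    rcases Nat.eq_zero_or_pos n with rfl | hn
    · simp [hF, hc0]
    · have h1 : ∀ t : ℝ, ‖F n t‖ = ‖c n‖ * ‖q‖ ^ n * Real.exp (-(2 * Real.pi * n / h) * t) := by
        intro t
        rw [hFeq, norm_mul, norm_mul, norm_pow, Complex.norm_real, Real.norm_eq_abs,
          Real.abs_exp]
      simp_rw [h1, integral_const_mul, integral_exp_mul_Ioi (ha n hn)]
      simp only [mul_zero, Real.exp_zero]
      congr 1
      field_simp
  -- summability of the integrals of the norms
  have hsum : Summable fun n ↦ ∫ t in Ioi (0 : ℝ), ‖F n t‖ := by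
    simp_rw [hnorm]
    refine Summable.of_nonneg_of_le (fun n ↦ by positivity) (fun n ↦ ?_)
      ((hφ.summable_norm_coeff_mul_pow (norm_nonneg q) hρ).mul_right (h / (2 * Real.pi)))
    rcases Nat.eq_zero_or_pos n with rfl | hn
    · simp only [CharP.cast_eq_zero, mul_zero, div_zero, pow_zero, mul_one]
      positivity
    · refine mul_le_mul_of_nonneg_left ?_ (by positivity)
      refine div_le_div_of_nonneg_left hh.le (by positivity) ?_
      exact le_mul_of_one_le_right (by positivity) (by exact_mod_cast hn)
  have H := hasSum_integral_of_summable_integral_norm hint hsum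
  have heq : ∫ t in Ioi (0 : ℝ), (∑' n, F n t) =
      ∫ t in Ioi (0 : ℝ), φ (ofComplex ((τ : ℂ) + t * I)) :=
    setIntegral_congr_fun measurableSet_Ioi fun t ht ↦ (hφ.hasSum_ray τ ht).tsum_eq
  have hval : (fun n ↦ ∫ t in Ioi (0 : ℝ), F n t) =
      fun n ↦ c n * q ^ n * (h / (2 * Real.pi * n)) := by
    funext n
    rcases Nat.eq_zero_or_pos n with rfl | hn
    · simp [hF, hc0]
    · simp_rw [hFeq, integral_const_mul, integral_complex_ofReal, integral_exp_mul_Ioi (ha n hn)]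
      simp only [mul_zero, Real.exp_zero]
      have : (-(2 * Real.pi * n / h) : ℝ) ≠ 0 := (ha n hn).ne
      congr 1
      push_cast
      field_simp
  rwa [heq, hval] at H

/-- **`q`-expansion of the vertical-ray integral**:
`V_φ(τ) = 2πi ∫_{i∞}^τ φ dz = ∑ₙ cₙ (h/n) q_h(τ)ⁿ` (Cremona 1997, §2.10, (2.10.2)–(2.10.3);
Manin 1972, §1.5). [cite: CremonaAlgorithms1997, §2.10] -/
theorem hasSum_verticalIntegral (τ : ℍ) :
    HasSum (fun n : ℕ ↦ (qExpansion h φ).coeff n * (h / n) * Periodic.qParam h τ ^ n)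
      (verticalIntegral φ τ) := by
  have H := (hφ.hasSum_integral_ray τ).mul_left (2 * (Real.pi : ℂ))
  have hfun : (fun n : ℕ ↦ 2 * (Real.pi : ℂ) * ((qExpansion h φ).coeff n *
      Periodic.qParam h τ ^ n * (h / (2 * Real.pi * n)))) =
      fun n : ℕ ↦ (qExpansion h φ).coeff n * (h / n) * Periodic.qParam h τ ^ n := by
    funext n
    rcases Nat.eq_zero_or_pos n with rfl | hn
    · simp [hφ.coeff_zero]
    · have : (n : ℂ) ≠ 0 := by exact_mod_cast hn.ne'
      have hπ : (Real.pi : ℂ) ≠ 0 := by exact_mod_cast Real.pi_ne_zero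
      field_simp
  rwa [hfun] at H

/-- **Exponential decay along vertical rays**: `|φ(τ + it)| ≤ (∑ |cₙ| |q_h(τ)|ⁿ) e^{-2πt/h}` for
`t > 0`. [folklore] -/
theorem norm_ray_le (τ : ℍ) {t : ℝ} (ht : 0 < t) :
    ‖φ (ofComplex ((τ : ℂ) + t * I))‖ ≤
      (∑' n : ℕ, ‖(qExpansion h φ).coeff n‖ * ‖Periodic.qParam h τ‖ ^ n) *
        Real.exp (-(2 * Real.pi / h) * t) := by
  have hρ : ‖Periodic.qParam h τ‖ < 1 := Periodic.norm_qParam_lt_one hφ.pos τ.im_pos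
  have hS := hφ.summable_norm_coeff_mul_pow (norm_nonneg _) hρ
  exact (hφ.hasSum_ray τ ht).norm_le_of_bounded (hS.hasSum.mul_right _)
    (hφ.norm_rayTerm_le τ ht)

/-- The vertical-ray integrand `t ↦ φ(τ + it)` is continuous on `(0, ∞)`. [folklore] -/
theorem continuousOn_ray (τ : ℍ) :
    ContinuousOn (fun t : ℝ ↦ φ (ofComplex ((τ : ℂ) + t * I))) (Ioi 0) := by
  refine hφ.continuousOn_comp_ofComplex.comp (by fun_prop) fun t ht ↦ ?_
  simpa using τ.im_pos.trans (by simpa using ht)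

/-- **Integrability along vertical rays** (discharges `integrableOn_eichlerIntegral_integrand`):
`t ↦ φ(τ + it)` is integrable on `(0, ∞)`, being continuous and `O(e^{-2πt/h})`
(Cremona 1997, §2.10). [cite: CremonaAlgorithms1997, §2.10] -/
theorem integrableOn_ray (τ : ℍ) :
    IntegrableOn (fun t : ℝ ↦ φ (ofComplex ((τ : ℂ) + t * I))) (Ioi 0) := by
  have hh := hφ.pos
  set C : ℝ := ∑' n : ℕ, ‖(qExpansion h φ).coeff n‖ * ‖Periodic.qParam h τ‖ ^ n
  have ha : -(2 * Real.pi / h) < 0 := by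
    have : 0 < 2 * Real.pi / h := by positivity
    linarith
  refine Integrable.mono' (g := fun t ↦ C * Real.exp (-(2 * Real.pi / h) * t))
    ((integrableOn_exp_mul_Ioi ha 0).const_mul C)
    ((hφ.continuousOn_ray τ).aestronglyMeasurable measurableSet_Ioi) ?_
  rw [ae_restrict_iff' measurableSet_Ioi]
  exact Eventually.of_forall fun t ht ↦ hφ.norm_ray_le τ ht

/-- Each `q`-series term `cₙ (h/n) q_h(w)ⁿ` has derivative `2πi cₙ q_h(w)ⁿ`. [folklore] -/
theorem hasDerivAt_term (n : ℕ) (w : ℂ) :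
    HasDerivAt (fun w : ℂ ↦ (qExpansion h φ).coeff n * (h / n) * Periodic.qParam h w ^ n)
      (2 * Real.pi * I * ((qExpansion h φ).coeff n * Periodic.qParam h w ^ n)) w := by
  have hh := hφ.pos.ne'
  rcases Nat.eq_zero_or_pos n with rfl | hn
  · simpa [hφ.coeff_zero] using hasDerivAt_const w (0 : ℂ)
  · -- `q_h(w)ⁿ = exp (n · 2πi w / h)`
    have hq : ∀ w : ℂ, Periodic.qParam h w ^ n = cexp ((2 * Real.pi * I * n / h) * w) := by
      intro w
      rw [Periodic.qParam, ← Complex.exp_nat_mul]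
      congr 1
      ring
    simp_rw [hq]
    have h1 : HasDerivAt (fun w : ℂ ↦ cexp ((2 * Real.pi * I * n / h) * w))
        (cexp ((2 * Real.pi * I * n / h) * w) * (2 * Real.pi * I * n / h)) w := by
      have := ((hasDerivAt_id w).const_mul (2 * Real.pi * I * n / h)).cexp
      simpa using this
    refine (h1.const_mul ((qExpansion h φ).coeff n * (h / n))).congr_deriv ?_
    have hn' : (n : ℂ) ≠ 0 := by exact_mod_cast hn.ne'
    have hh' : (h : ℂ) ≠ 0 := by exact_mod_cast hh
    field_simp

/-- **The vertical-ray integral is a primitive of `2πi φ`**: `z ↦ V_φ(z)` is holomorphic on the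
upper half-plane with `d/dz V_φ(z) = 2πi φ(z)` (termwise differentiation of
`∑ cₙ (h/n) q_hⁿ`, locally uniformly convergent) (Cremona 1997, §2.10; Manin 1972, §1.5). [cite: CremonaAlgorithms1997, §2.10] -/
theorem hasDerivAt_verticalIntegral {z : ℂ} (hz : 0 < z.im) :
    HasDerivAt (fun w : ℂ ↦ verticalIntegral φ (ofComplex w))
      (2 * Real.pi * I * φ (ofComplex z)) z := by
  have hh := hφ.pos
  set c : ℕ → ℂ := fun n ↦ (qExpansion h φ).coeff n with hc
  set y : ℝ := z.im / 2 with hy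
  have hy0 : 0 < y := by positivity
  set U : Set ℂ := {w : ℂ | y < w.im}
  have hUo : IsOpen U := isOpen_lt continuous_const Complex.continuous_im
  have hUc : IsPreconnected U := (convex_halfSpace_im_gt y).isPreconnected
  have hzU : z ∈ U := by simp [U, hy]; linarith
  set ρ : ℝ := Real.exp (-2 * Real.pi * y / h)
  have hρ0 : 0 ≤ ρ := (Real.exp_pos _).le
  have hρ1 : ρ < 1 := by
    apply Real.exp_lt_one_iff.mpr
    have : 0 < 2 * Real.pi * y / h := by positivity
    rw [neg_mul, neg_mul, neg_div]
    linarith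
  -- bound for the derivatives on `U`
  have hqU : ∀ w ∈ U, ‖Periodic.qParam h w‖ ≤ ρ := by
    intro w hw
    rw [Periodic.norm_qParam]
    apply Real.exp_le_exp.mpr
    have : 2 * Real.pi * y / h ≤ 2 * Real.pi * w.im / h := by
      gcongr
      exact le_of_lt hw
    have e1 : -2 * Real.pi * w.im / h = -(2 * Real.pi * w.im / h) := by ring
    have e2 : -2 * Real.pi * y / h = -(2 * Real.pi * y / h) := by ring
    rw [e1, e2]
    linarith
  have hbd : ∀ n (w : ℂ), w ∈ U →
      ‖2 * Real.pi * I * (c n * Periodic.qParam h w ^ n)‖ ≤ 2 * Real.pi * (‖c n‖ * ρ ^ n) := by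
    intro n w hw
    have : ‖2 * (Real.pi : ℂ) * I‖ = 2 * Real.pi := by
      simp [Real.pi_pos.le]
    rw [norm_mul, this, norm_mul, norm_pow]
    gcongr
    exact hqU w hw
  have hsum : Summable fun n ↦ 2 * Real.pi * (‖c n‖ * ρ ^ n) :=
    (hφ.summable_norm_coeff_mul_pow hρ0 hρ1).mul_left _
  have hz0 : Summable fun n ↦ c n * (h / n) * Periodic.qParam h z ^ n :=
    (hφ.hasSum_verticalIntegral ⟨z, hz⟩).summable
  have H := hasDerivAt_tsum_of_isPreconnected hsum hUo hUc (fun n w _ ↦ hφ.hasDerivAt_term n w)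
    hbd hzU hz0 hzU
  -- identify the sum of the derivatives and the function
  have hderiv : ∑' n, 2 * Real.pi * I * (c n * Periodic.qParam h z ^ n) =
      2 * Real.pi * I * φ (ofComplex z) := by
    rw [tsum_mul_left, (hφ.hasSum ⟨z, hz⟩).tsum_eq, ofComplex_apply_of_im_pos hz]
  rw [hderiv] at H
  refine H.congr_of_eventuallyEq ?_
  filter_upwards [isOpen_upperHalfPlaneSet.mem_nhds hz] with w (hw : 0 < w.im)
  have := (hφ.hasSum_verticalIntegral (ofComplex w)).tsum_eq
  rw [ofComplex_apply_of_im_pos hw] at this ⊢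
  exact this.symm

/-- `V_φ ∘ ofComplex` is holomorphic on the upper half-plane. [folklore] -/
theorem differentiableOn_verticalIntegral :
    DifferentiableOn ℂ (fun w : ℂ ↦ verticalIntegral φ (ofComplex w)) {z : ℂ | 0 < z.im} :=
  fun _ hz ↦ (hφ.hasDerivAt_verticalIntegral hz).differentiableAt.differentiableWithinAt

end IsCuspFunction

/-! ### Cusp forms on `Γ₀(N)` and their `SL(2, ℤ)`-translates are cuspidal `q`-series -/

section Slash

variable {N : ℕ} {k : ℤ}

/-- `g Tᴺ g⁻¹ ∈ Γ₀(N)` for every `g ∈ SL(2, ℤ)` (`Tᴺ ∈ Γ(N)`, which is normal). [folklore] -/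
theorem conj_T_zpow_mem_Gamma0 (g : SL(2, ℤ)) :
    g * ModularGroup.T ^ (N : ℤ) * g⁻¹ ∈ Gamma0 N := by
  have hT : ModularGroup.T ^ (N : ℤ) ∈ CongruenceSubgroup.Gamma N := by
    simpa using ModularGroup_T_pow_mem_Gamma N N dvd_rfl
  have := (Gamma_normal N).conj_mem _ hT g
  rw [Gamma_mem] at this
  rw [Gamma0_mem]
  exact this.2.2.1

/-- An `SL(2, ℤ)`-translate `f ∣[k] g` of a cusp form on `Γ₀(N)` is `Tᴺ`-invariant:
`f ∣[k] g ∣[k] Tᴺ = f ∣[k] (g Tᴺ g⁻¹) g = f ∣[k] g`. [folklore] -/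
theorem slash_T_zpow (f : CuspForm (Gamma0 N) k) (g : SL(2, ℤ)) :
    (⇑f ∣[k] g) ∣[k] (ModularGroup.T ^ (N : ℤ)) = ⇑f ∣[k] g := by
  have h1 : ⇑f ∣[k] (g * ModularGroup.T ^ (N : ℤ) * g⁻¹) = ⇑f := by
    rw [ModularForm.SL_slash]
    exact SlashInvariantForm.slash_action_eqn f _
      (Subgroup.mem_map_of_mem (Matrix.SpecialLinearGroup.mapGL ℝ) (conj_T_zpow_mem_Gamma0 g))
  calc (⇑f ∣[k] g) ∣[k] (ModularGroup.T ^ (N : ℤ))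
      = ⇑f ∣[k] ((g * ModularGroup.T ^ (N : ℤ) * g⁻¹) * g) := by
        rw [← SlashAction.slash_mul]; congr 1; group
    _ = ⇑f ∣[k] g := by rw [SlashAction.slash_mul, h1]

/-- Hence `(f ∣[k] g)(τ + N) = (f ∣[k] g)(τ)`, i.e. `(f ∣[k] g) ∘ ofComplex` is `N`-periodic.
[folklore] -/
theorem periodic_slash (f : CuspForm (Gamma0 N) k) (g : SL(2, ℤ)) :
    Periodic ((⇑f ∣[k] g) ∘ ofComplex) (N : ℝ) := by
  intro w
  by_cases hw : 0 < w.im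
  · have hw' : 0 < (w + (N : ℝ)).im := by simpa using hw
    have hT : ModularGroup.T ^ (N : ℤ) • ofComplex w = ofComplex (w + (N : ℝ)) := by
      ext1
      rw [ModularGroup.coe_T_zpow_smul_eq, ofComplex_apply_of_im_pos hw,
        ofComplex_apply_of_im_pos hw']
      simp
    have := congr_fun (slash_T_zpow f g) (ofComplex w)
    rw [ModularForm.SL_slash_apply, hT] at this
    simp only [comp_apply]
    rw [← this]
    have hd : denom (ModularGroup.T ^ (N : ℤ) : SL(2, ℤ)) (ofComplex w) = 1 := by
      rw [ModularGroup.denom_apply, ModularGroup.coe_T_zpow]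
      simp
    rw [hd, one_zpow, mul_one]
  · have hw' : (w + (N : ℝ)).im ≤ 0 := by simpa using hw
    simp only [comp_apply, ofComplex_apply_eq_of_im_nonpos hw' (not_lt.mp hw)]

/-- **`SL(2, ℤ)`-translates of cusp forms on `Γ₀(N)` are cuspidal `q`-series of period `N`.**
[folklore] -/
theorem isCuspFunction_slash [NeZero N] (f : CuspForm (Gamma0 N) k) (g : SL(2, ℤ)) :
    IsCuspFunction N (⇑f ∣[k] g) where
  pos := by exact_mod_cast Nat.pos_of_ne_zero (NeZero.ne N)
  periodic := periodic_slash f g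
  mdifferentiable := by
    rw [ModularForm.SL_slash]
    exact (ModularFormClass.holo f).slash k _
  isZeroAtImInfty := CuspFormClass.zero_at_infty_slash f g

/-- **Cusp forms on `Γ₀(N)` are cuspidal `q`-series of period `1`.** [folklore] -/
theorem isCuspFunction_one [NeZero N] (f : CuspForm (Gamma0 N) k) : IsCuspFunction 1 ⇑f where
  pos := one_pos
  periodic := by
    have hΓ : (1 : ℝ) ∈ (Gamma0 N : Subgroup (GL (Fin 2) ℝ)).strictPeriods := by
      rw [CongruenceSubgroup.strictPeriods_Gamma0]
      exact AddSubgroup.mem_zmultiples 1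
    exact SlashInvariantFormClass.periodic_comp_ofComplex f hΓ
  mdifferentiable := ModularFormClass.holo f
  isZeroAtImInfty := CuspFormClass.zero_at_infty f

end Slash

/-! ### Möbius transformations on `ℂ` and weight-`2` invariance of `V` -/

section Moebius

/-- The Möbius transformation `z ↦ (az + b)/(cz + d)` of `g = (a b; c d) ∈ SL(2, ℤ)` on `ℂ`
(agrees with `g • τ` on `ℍ`, `coe_smul_ofComplex`). [folklore] -/
def moebius (g : SL(2, ℤ)) (z : ℂ) : ℂ :=
  ((g 0 0 : ℤ) * z + (g 0 1 : ℤ)) / ((g 1 0 : ℤ) * z + (g 1 1 : ℤ))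

/-- On `ℍ`, `g • z` is the Möbius transformation `moebius g z`. [folklore] -/
theorem coe_smul_ofComplex (g : SL(2, ℤ)) {z : ℂ} (hz : 0 < z.im) :
    ((g • ofComplex z : ℍ) : ℂ) = moebius g z := by
  rw [coe_specialLinearGroup_apply, ofComplex_apply_of_im_pos hz]
  simp [moebius]

/-- `g • z = moebius g z` as points of `ℍ` (`im z > 0`). [folklore] -/
theorem smul_ofComplex (g : SL(2, ℤ)) {z : ℂ} (hz : 0 < z.im) :
    g • ofComplex z = ofComplex (moebius g z) := by
  rw [← ofComplex_apply (g • ofComplex z), coe_smul_ofComplex g hz]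

/-- Möbius transformations of `SL(2, ℤ)` preserve the upper half-plane. [folklore] -/
theorem moebius_im_pos (g : SL(2, ℤ)) {z : ℂ} (hz : 0 < z.im) : 0 < (moebius g z).im := by
  rw [← coe_smul_ofComplex g hz]
  exact (g • ofComplex z).im_pos

/-- `denom g z = cz + d` for `im z > 0`. [folklore] -/
theorem denom_ofComplex (g : SL(2, ℤ)) {z : ℂ} (hz : 0 < z.im) :
    denom (g : GL (Fin 2) ℝ) (ofComplex z) = (g 1 0 : ℤ) * z + (g 1 1 : ℤ) := by
  rw [ModularGroup.denom_apply, ofComplex_apply_of_im_pos hz]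

/-- `cz + d ≠ 0` for `im z > 0`. [folklore] -/
theorem moebius_denom_ne_zero (g : SL(2, ℤ)) {z : ℂ} (hz : 0 < z.im) :
    (g 1 0 : ℤ) * z + (g 1 1 : ℤ) ≠ (0 : ℂ) := by
  rw [← denom_ofComplex g hz]
  exact denom_ne_zero _ _

/-- `d/dz (az + b)/(cz + d) = (cz + d)⁻²` for `ad - bc = 1`. [folklore] -/
theorem hasDerivAt_moebius (g : SL(2, ℤ)) {z : ℂ} (hz : 0 < z.im) :
    HasDerivAt (moebius g) (1 / ((g 1 0 : ℤ) * z + (g 1 1 : ℤ)) ^ 2) z := by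
  have hd := moebius_denom_ne_zero g hz
  have hnum : HasDerivAt (fun z : ℂ ↦ (g 0 0 : ℤ) * z + (g 0 1 : ℤ)) ((g 0 0 : ℤ) : ℂ) z := by
    simpa using ((hasDerivAt_id z).const_mul ((g 0 0 : ℤ) : ℂ)).add_const ((g 0 1 : ℤ) : ℂ)
  have hden : HasDerivAt (fun z : ℂ ↦ (g 1 0 : ℤ) * z + (g 1 1 : ℤ)) ((g 1 0 : ℤ) : ℂ) z := by
    simpa using ((hasDerivAt_id z).const_mul ((g 1 0 : ℤ) : ℂ)).add_const ((g 1 1 : ℤ) : ℂ)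
  have hdet : ((g 0 0 : ℤ) : ℂ) * (g 1 1 : ℤ) - (g 0 1 : ℤ) * (g 1 0 : ℤ) = 1 := by
    have := Matrix.SpecialLinearGroup.det_coe g
    rw [Matrix.det_fin_two] at this
    exact_mod_cast this
  refine (hnum.div hden hd).congr_deriv ?_
  rw [← hdet]
  ring

variable {h₁ h₂ : ℝ} {φ : ℍ → ℂ} (g : SL(2, ℤ))

/-- **Weight-`2` invariance of the Eichler integral, differential form**: if `φ` and
`ψ = φ ∣[2] g` are cuspidal `q`-series, then `z ↦ V_φ(gz) - V_ψ(z)` has derivative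
`2πi φ(gz) (cz + d)⁻² - 2πi (φ ∣[2] g)(z) = 0` on `ℍ` (Manin 1972, Prop. 1.4; Cremona 1997,
Prop. 2.1.1 (3)). [cite: Manin1972, Prop. 1.4] -/
theorem hasDerivAt_verticalIntegral_smul_sub (hφ : IsCuspFunction h₁ φ)
    (hψ : IsCuspFunction h₂ (φ ∣[(2 : ℤ)] g)) {z : ℂ} (hz : 0 < z.im) :
    HasDerivAt (fun w : ℂ ↦ verticalIntegral φ (ofComplex (moebius g w)) -
      verticalIntegral (φ ∣[(2 : ℤ)] g) (ofComplex w)) 0 z := by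
  have h1 := (hφ.hasDerivAt_verticalIntegral (moebius_im_pos g hz)).comp z
    (hasDerivAt_moebius g hz)
  have h2 := hψ.hasDerivAt_verticalIntegral hz
  refine (h1.sub h2).congr_deriv ?_
  rw [ModularForm.SL_slash_apply, smul_ofComplex g hz, denom_ofComplex g hz, zpow_neg]
  field_simp [moebius_denom_ne_zero g hz]
  ring

/-- **`V_φ(gτ) - V_{φ|g}(τ)` is independent of `τ`** (`ℍ` is connected and the derivative
vanishes) (Manin 1972, Prop. 1.4 (period `{τ, gτ}` independent of `τ`); Cremona 1997,
Prop. 2.1.1 (3)). [cite: Manin1972, Prop. 1.4] -/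
theorem verticalIntegral_smul_sub_eq (hφ : IsCuspFunction h₁ φ)
    (hψ : IsCuspFunction h₂ (φ ∣[(2 : ℤ)] g)) (τ τ' : ℍ) :
    verticalIntegral φ (g • τ) - verticalIntegral (φ ∣[(2 : ℤ)] g) τ =
      verticalIntegral φ (g • τ') - verticalIntegral (φ ∣[(2 : ℤ)] g) τ' := by
  set D : ℂ → ℂ := fun w ↦ verticalIntegral φ (ofComplex (moebius g w)) -
      verticalIntegral (φ ∣[(2 : ℤ)] g) (ofComplex w)
  have hD : ∀ σ : ℍ, D σ = verticalIntegral φ (g • σ) - verticalIntegral (φ ∣[(2 : ℤ)] g) σ := by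
    intro σ
    simp only [D]
    rw [← smul_ofComplex g σ.im_pos, ofComplex_apply]
  rw [← hD, ← hD]
  refine isOpen_upperHalfPlaneSet.is_const_of_deriv_eq_zero
    (convex_halfSpace_im_gt 0).isPreconnected
    (fun w hw ↦ (hasDerivAt_verticalIntegral_smul_sub g hφ hψ hw).differentiableAt
      |>.differentiableWithinAt)
    (fun w hw ↦ (hasDerivAt_verticalIntegral_smul_sub g hφ hψ hw).deriv) τ.im_pos τ'.im_pos

end Moebius



/-! ### The vertical ray above `γ⁻¹∞` maps onto the vertical ray above `γ∞` -/

section Ray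

/-- Translation of integrals over rays: `∫_{(T, ∞)} F = ∫_{(0, ∞)} F(t + T)`. [folklore] -/
theorem integral_Ioi_eq_integral_Ioi_add {E : Type*} [NormedAddCommGroup E] [NormedSpace ℝ E]
    (F : ℝ → E) (T : ℝ) : ∫ u in Ioi T, F u = ∫ t in Ioi (0 : ℝ), F (t + T) := by
  have := integral_image_eq_integral_abs_deriv_smul (f := fun t : ℝ ↦ t + T) (f' := fun _ ↦ 1)
    (s := Ioi 0) measurableSet_Ioi (fun t _ ↦ (hasDerivAt_id t).add_const T |>.hasDerivWithinAt)
    (fun x _ y _ h ↦ by simpa using h) F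
  simpa using this

/-- Translation of integrability over rays. [folklore] -/
theorem integrableOn_Ioi_iff_integrableOn_Ioi_add {E : Type*} [NormedAddCommGroup E]
    [NormedSpace ℝ E] (F : ℝ → E) (T : ℝ) :
    IntegrableOn F (Ioi T) ↔ IntegrableOn (fun t ↦ F (t + T)) (Ioi (0 : ℝ)) := by
  have := integrableOn_image_iff_integrableOn_abs_deriv_smul (f := fun t : ℝ ↦ t + T)
    (f' := fun _ ↦ 1) (s := Ioi 0) measurableSet_Ioi
    (fun t _ ↦ (hasDerivAt_id t).add_const T |>.hasDerivWithinAt) (fun x _ y _ h ↦ by simpa using h) F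
  simpa using this

variable {N : ℕ} (f : CuspForm (Gamma0 N) 2) (g : SL(2, ℤ))

/-- `c(-d/c + uI) + d = cu i`. [folklore] -/
theorem denom_ray (hc : (g 1 0 : ℤ) ≠ 0) (u : ℝ) :
    ((g 1 0 : ℤ) : ℂ) * (-((g 1 1 : ℤ) : ℂ) / ((g 1 0 : ℤ) : ℂ) + u * I) + ((g 1 1 : ℤ) : ℂ) =
      ((g 1 0 : ℤ) : ℂ) * u * I := by
  have hc' : ((g 1 0 : ℤ) : ℂ) ≠ 0 := by exact_mod_cast hc
  field_simp
  ring

/-- **`γ` maps the vertical ray above `γ⁻¹∞ = -d/c` onto the vertical ray above `γ∞ = a/c`**: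
`γ(-d/c + iu) = a/c + i/(c²u)` for `γ = (a b; c d)`, `c ≠ 0` (Cremona 1997, §2.1;
Manin 1972, §1.6). [folklore] -/
theorem moebius_ray (hc : (g 1 0 : ℤ) ≠ 0) {u : ℝ} (hu : u ≠ 0) :
    moebius g (-((g 1 1 : ℤ) : ℂ) / ((g 1 0 : ℤ) : ℂ) + u * I) =
      ((g 0 0 : ℤ) : ℂ) / ((g 1 0 : ℤ) : ℂ) + ((1 / (((g 1 0 : ℤ) : ℝ) ^ 2 * u) : ℝ) : ℂ) * I := by
  have hc' : ((g 1 0 : ℤ) : ℂ) ≠ 0 := by exact_mod_cast hc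
  have hu' : (u : ℂ) ≠ 0 := by exact_mod_cast hu
  have hdet : ((g 0 0 : ℤ) : ℂ) * (g 1 1 : ℤ) - (g 0 1 : ℤ) * (g 1 0 : ℤ) = 1 := by
    have := Matrix.SpecialLinearGroup.det_coe g
    rw [Matrix.det_fin_two] at this
    exact_mod_cast this
  rw [moebius, denom_ray g hc u]
  have hI : ((g 1 0 : ℤ) : ℂ) * u * I ≠ 0 := mul_ne_zero (mul_ne_zero hc' hu') I_ne_zero
  push_cast
  field_simp
  linear_combination -hdet - I_sq

/-- **Weight-`2` transformation along the ray**: with `t = 1/(c²u)`,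
`f(a/c + it) · |dt/du| = f(γ(-d/c + iu)) / (c²u²) = -(f ∣[2] γ)(-d/c + iu)` since
`(c(-d/c + iu) + d)² = -c²u²` (Cremona 1997, §2.1, §2.10). [folklore] -/
theorem jacobian_smul_ray (hc : (g 1 0 : ℤ) ≠ 0) {u : ℝ} (hu : 0 < u) :
    |(-(1 / (((g 1 0 : ℤ) : ℝ) ^ 2 * u ^ 2)) : ℝ)| •
      f (ofComplex (((g 0 0 : ℤ) : ℂ) / ((g 1 0 : ℤ) : ℂ) +
        ((1 / (((g 1 0 : ℤ) : ℝ) ^ 2 * u) : ℝ) : ℂ) * I)) =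
      -(⇑f ∣[(2 : ℤ)] g) (ofComplex (-((g 1 1 : ℤ) : ℂ) / ((g 1 0 : ℤ) : ℂ) + u * I)) := by
  have hc' : ((g 1 0 : ℤ) : ℂ) ≠ 0 := by exact_mod_cast hc
  have hcR : ((g 1 0 : ℤ) : ℝ) ≠ 0 := by exact_mod_cast hc
  have hu' : (u : ℂ) ≠ 0 := by exact_mod_cast hu.ne'
  have him : 0 < (-((g 1 1 : ℤ) : ℂ) / ((g 1 0 : ℤ) : ℂ) + u * I).im := by
    simpa [div_im] using hu  -- im of real/real = 0
  rw [ModularForm.SL_slash_apply, smul_ofComplex g him, moebius_ray g hc hu.ne',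
    denom_ofComplex g him, denom_ray g hc u, abs_of_neg (by
      have : 0 < 1 / (((g 1 0 : ℤ) : ℝ) ^ 2 * u ^ 2) := by positivity
      linarith), Complex.real_smul]
  push_cast
  rw [zpow_neg, zpow_two]
  field_simp
  rw [I_sq]
  ring

/-- `u ↦ 1/(c²u)` maps `(1/|c|, ∞)` onto `(0, 1/|c|)`. [folklore] -/
theorem image_inv_ray {C : ℝ} (hC : C ≠ 0) :
    (fun u : ℝ ↦ 1 / (C ^ 2 * u)) '' Ioi (1 / |C|) = Ioo 0 (1 / |C|) := by
  have hCa : 0 < |C| := abs_pos.mpr hC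
  have hsq : C ^ 2 = |C| * |C| := by rw [← sq_abs]; ring
  ext t
  simp only [mem_image, mem_Ioi, mem_Ioo]
  constructor
  · rintro ⟨u, hu, rfl⟩
    have hu0 : 0 < u := lt_trans (by positivity) hu
    have hu1 : 1 < u * |C| := (div_lt_iff₀ hCa).mp hu
    refine ⟨by positivity, ?_⟩
    rw [one_div_lt_one_div (by positivity) hCa, hsq]
    nlinarith
  · rintro ⟨h0, ht⟩
    have ht1 : t * |C| < 1 := (lt_div_iff₀ hCa).mp ht
    refine ⟨1 / (C ^ 2 * t), ?_, ?_⟩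
    · rw [one_div_lt_one_div hCa (by positivity), hsq]
      nlinarith
    · field_simp

/-- The base point `w₀ = -d/c + i/|c|` on the vertical ray above `γ⁻¹∞ = -d/c`; `γ w₀ = a/c + i/|c|`
lies on the vertical ray above `γ∞ = a/c` at the same height. [folklore] -/
def rayBase (g : SL(2, ℤ)) : ℂ :=
  -((g 1 1 : ℤ) : ℂ) / ((g 1 0 : ℤ) : ℂ) + ((1 / |((g 1 0 : ℤ) : ℝ)| : ℝ) : ℂ) * I

/-- `im w₀ = 1/|c|`. [folklore] -/
theorem rayBase_im_eq : (rayBase g).im = 1 / |((g 1 0 : ℤ) : ℝ)| := by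
  simp only [rayBase, add_im, neg_div, neg_im, Complex.div_intCast_im, intCast_im, zero_div,
    neg_zero, zero_add, mul_im, ofReal_re, Complex.I_im, mul_one, ofReal_im, Complex.I_re,
    mul_zero, add_zero]

/-- `w₀ ∈ ℍ` when `c ≠ 0`. [folklore] -/
theorem rayBase_im (hc : (g 1 0 : ℤ) ≠ 0) : 0 < (rayBase g).im := by
  have : (0 : ℝ) < |((g 1 0 : ℤ) : ℝ)| := abs_pos.mpr (by exact_mod_cast hc)
  rw [rayBase_im_eq]
  positivity

/-- `ofComplex w₀ = w₀`. [folklore] -/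
theorem coe_ofComplex_rayBase (hc : (g 1 0 : ℤ) ≠ 0) :
    ((ofComplex (rayBase g) : ℍ) : ℂ) = rayBase g := by
  rw [ofComplex_apply_of_im_pos (rayBase_im g hc), UpperHalfPlane.coe_mk]

/-- `1/(c² · (1/|c|)) = 1/|c|`: `γ w₀` has the same height as `w₀`. [folklore] -/
theorem one_div_sq_mul (hc : (g 1 0 : ℤ) ≠ 0) :
    1 / (((g 1 0 : ℤ) : ℝ) ^ 2 * (1 / |((g 1 0 : ℤ) : ℝ)|)) = 1 / |((g 1 0 : ℤ) : ℝ)| := by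
  have hC : (0 : ℝ) < |((g 1 0 : ℤ) : ℝ)| := abs_pos.mpr (by exact_mod_cast hc)
  rw [← sq_abs]
  field_simp

/-- `γ w₀ = a/c + i/|c|`. [folklore] -/
theorem coe_smul_rayBase (hc : (g 1 0 : ℤ) ≠ 0) :
    ((g • ofComplex (rayBase g) : ℍ) : ℂ) =
      ((g 0 0 : ℤ) : ℂ) / ((g 1 0 : ℤ) : ℂ) + ((1 / |((g 1 0 : ℤ) : ℝ)| : ℝ) : ℂ) * I := by
  have hC : (0 : ℝ) < |((g 1 0 : ℤ) : ℝ)| := abs_pos.mpr (by exact_mod_cast hc)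
  rw [coe_smul_ofComplex g (rayBase_im g hc), rayBase, moebius_ray g hc (by positivity),
    one_div_sq_mul g hc]

/-- `d/du (1/(C²u)) = -1/(C²u²)`. [folklore] -/
theorem hasDerivAt_inv_ray {C : ℝ} (hC : C ≠ 0) {u : ℝ} (hu : u ≠ 0) :
    HasDerivAt (fun u : ℝ ↦ 1 / (C ^ 2 * u)) (-(1 / (C ^ 2 * u ^ 2))) u := by
  have h := (hasDerivAt_const u (1 : ℝ)).div ((hasDerivAt_id u).const_mul (C ^ 2))
    (mul_ne_zero (pow_ne_zero 2 hC) hu)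
  refine h.congr_deriv ?_
  simp only [id_eq]
  field_simp
  ring

/-- `u ↦ 1/(C²u)` is injective. [folklore] -/
theorem injOn_inv_ray {C : ℝ} (hC : C ≠ 0) (s : Set ℝ) : InjOn (fun u : ℝ ↦ 1 / (C ^ 2 * u)) s := by
  intro x _ y _ hxy
  have hC2 : C ^ 2 ≠ 0 := pow_ne_zero 2 hC
  simp only [one_div, inv_inj] at hxy
  exact mul_left_cancel₀ hC2 hxy

variable [NeZero N]

/-- **Integrability of the modular-symbol integrand at a cusp `γ∞`** (`γ ∈ SL(2, ℤ)`,
`c ≠ 0`): `t ↦ f(a/c + it)` is integrable on `(0, ∞)`; near `t = 0` substitute `t = 1/(c²u)`,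
which turns it into `-(f ∣[2] γ)(-d/c + iu)`, `u → ∞`, integrable by cuspidality of `f ∣[2] γ`
at `∞` (Manin 1972, §1.5; Cremona 1997, §2.10). [cite: Manin1972, §1.5] -/
theorem integrableOn_modularSymbol_integrand_smul (hc : (g 1 0 : ℤ) ≠ 0) :
    IntegrableOn (fun t : ℝ ↦ f (ofComplex (((g 0 0 : ℤ) : ℂ) / ((g 1 0 : ℤ) : ℂ) + t * I)))
      (Ioi 0) := by
  have hCR : ((g 1 0 : ℤ) : ℝ) ≠ 0 := by exact_mod_cast hc
  have hCa : (0 : ℝ) < |((g 1 0 : ℤ) : ℝ)| := abs_pos.mpr hCR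
  have hT : (0 : ℝ) < 1 / |((g 1 0 : ℤ) : ℝ)| := by positivity
  -- the tail `(1/|c|, ∞)`: a translate of the ray above `γ w₀`
  have htail : IntegrableOn
      (fun t : ℝ ↦ f (ofComplex (((g 0 0 : ℤ) : ℂ) / ((g 1 0 : ℤ) : ℂ) + t * I)))
      (Ioi (1 / |((g 1 0 : ℤ) : ℝ)|)) := by
    rw [integrableOn_Ioi_iff_integrableOn_Ioi_add]
    have := (isCuspFunction_one f).integrableOn_ray (g • ofComplex (rayBase g))
    rw [coe_smul_rayBase g hc] at this
    refine this.congr_fun (fun t _ ↦ ?_) measurableSet_Ioi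
    dsimp only
    congr 2
    push_cast
    ring
  -- the head `(0, 1/|c|)`: image of the ray above `w₀` under `u ↦ 1/(c²u)`
  have hhead : IntegrableOn
      (fun t : ℝ ↦ f (ofComplex (((g 0 0 : ℤ) : ℂ) / ((g 1 0 : ℤ) : ℂ) + t * I)))
      (Ioo 0 (1 / |((g 1 0 : ℤ) : ℝ)|)) := by
    rw [← image_inv_ray hCR, integrableOn_image_iff_integrableOn_abs_deriv_smul
      measurableSet_Ioi (fun u hu ↦ (hasDerivAt_inv_ray hCR
        (lt_trans hT hu).ne').hasDerivWithinAt) (injOn_inv_ray hCR _)]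
    have H : IntegrableOn (fun u : ℝ ↦ (⇑f ∣[(2 : ℤ)] g)
        (ofComplex (-((g 1 1 : ℤ) : ℂ) / ((g 1 0 : ℤ) : ℂ) + u * I)))
        (Ioi (1 / |((g 1 0 : ℤ) : ℝ)|)) := by
      rw [integrableOn_Ioi_iff_integrableOn_Ioi_add]
      have := (isCuspFunction_slash f g).integrableOn_ray (ofComplex (rayBase g))
      rw [coe_ofComplex_rayBase g hc] at this
      refine this.congr_fun (fun t _ ↦ ?_) measurableSet_Ioi
      dsimp only
      rw [rayBase]
      push_cast
      ring_nf
    refine H.neg.congr_fun (fun u hu ↦ ?_) measurableSet_Ioi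
    simp only [Pi.neg_apply]
    exact (jacobian_smul_ray f g hc (lt_trans hT hu)).symm
  rw [← Ioc_union_Ioi_eq_Ioi hT.le]
  exact ((integrableOn_Ioc_iff_integrableOn_Ioo).mpr hhead).union htail

/-- **The modular symbol `{∞, γ∞}` as a difference of Eichler integrals**: for `γ ∈ SL(2, ℤ)`
with `c ≠ 0` and every `τ ∈ ℍ`,
`{∞, a/c}_f = V_f(γτ) - V_{f|γ}(τ)` where `V_φ(τ) = 2πi ∫_{i∞}^τ φ`.
Proof: split `∫₀^∞ f(a/c + it) dt` at `t = 1/|c|`; the tail is `V_f(γw₀)/2π`, and the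
substitution `t = 1/(c²u)` (`γ` maps the ray above `-d/c` onto the ray above `a/c`) turns the
head into `-V_{f|γ}(w₀)/2π`; finally `V_f(γτ) - V_{f|γ}(τ)` is independent of `τ`
(Manin 1972, Prop. 1.4, §1.6; Cremona 1997, Prop. 2.1.1, §2.10). [cite: Manin1972, Prop. 1.4] -/
theorem modularSymbol_smul_infty (hc : (g 1 0 : ℤ) ≠ 0) (τ : ℍ) :
    modularSymbol f (((g 0 0 : ℤ) : ℚ) / ((g 1 0 : ℤ) : ℚ)) =
      eichlerIntegral f (g • τ) - verticalIntegral (⇑f ∣[(2 : ℤ)] g) τ := by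
  have hCR : ((g 1 0 : ℤ) : ℝ) ≠ 0 := by exact_mod_cast hc
  have hCa : (0 : ℝ) < |((g 1 0 : ℤ) : ℝ)| := abs_pos.mpr hCR
  have hT : (0 : ℝ) < 1 / |((g 1 0 : ℤ) : ℝ)| := by positivity
  rw [show eichlerIntegral f (g • τ) = verticalIntegral ⇑f (g • τ) from rfl,
    verticalIntegral_smul_sub_eq g (isCuspFunction_one f) (isCuspFunction_slash f g) τ
      (ofComplex (rayBase g))]
  set G : ℝ → ℂ := fun t ↦ f (ofComplex (((g 0 0 : ℤ) : ℂ) / ((g 1 0 : ℤ) : ℂ) + t * I))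
    with hG
  have hGi := integrableOn_modularSymbol_integrand_smul f g hc
  -- tail
  have htail : ∫ t in Ioi (1 / |((g 1 0 : ℤ) : ℝ)|), G t =
      ∫ t in Ioi (0 : ℝ), f (ofComplex (((g • ofComplex (rayBase g) : ℍ) : ℂ) + t * I)) := by
    rw [integral_Ioi_eq_integral_Ioi_add]
    refine setIntegral_congr_fun measurableSet_Ioi fun t _ ↦ ?_
    simp only [hG, coe_smul_rayBase g hc]
    congr 2
    push_cast
    ring
  -- head
  have hhead : ∫ t in Ioo 0 (1 / |((g 1 0 : ℤ) : ℝ)|), G t =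
      -∫ t in Ioi (0 : ℝ), (⇑f ∣[(2 : ℤ)] g)
        (ofComplex (((ofComplex (rayBase g) : ℍ) : ℂ) + t * I)) := by
    rw [← image_inv_ray hCR, integral_image_eq_integral_abs_deriv_smul
      measurableSet_Ioi (fun u hu ↦ (hasDerivAt_inv_ray hCR
        (lt_trans hT hu).ne').hasDerivWithinAt) (injOn_inv_ray hCR _),
      ← integral_neg, integral_Ioi_eq_integral_Ioi_add]
    refine setIntegral_congr_fun measurableSet_Ioi fun u hu ↦ ?_
    rw [hG, jacobian_smul_ray f g hc (add_pos hu hT), coe_ofComplex_rayBase g hc]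
    congr 3
    rw [rayBase]
    push_cast
    ring_nf
  have hsplit : ∫ t in Ioi (0 : ℝ), G t =
      (∫ t in Ioo 0 (1 / |((g 1 0 : ℤ) : ℝ)|), G t) + ∫ t in Ioi (1 / |((g 1 0 : ℤ) : ℝ)|), G t := by
    rw [← Ioc_union_Ioi_eq_Ioi hT.le, setIntegral_union (Ioc_disjoint_Ioi le_rfl)
      measurableSet_Ioi (hGi.mono_set Ioc_subset_Ioi_self) (hGi.mono_set (Ioi_subset_Ioi hT.le)),
      integral_Ioc_eq_integral_Ioo]
  simp only [modularSymbol, verticalIntegral]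
  push_cast
  rw [hsplit, hhead, htail]
  ring

end Ray


/-! ### A matrix `δ_r ∈ SL(2, ℤ)` with `δ_r ∞ = r` -/

section CuspMatrix

/-- For a rational `r = p/q` in lowest terms, the matrix `δ_r = (p -y; q x) ∈ SL(2, ℤ)` with
`px + qy = 1` (Bézout), so that `δ_r ∞ = p/q = r` (Cremona 1997, §2.1.5, §2.2). [folklore] -/
def cuspMatrix (r : ℚ) : SL(2, ℤ) :=
  ⟨!![r.num, -Int.gcdB r.num r.den; (r.den : ℤ), Int.gcdA r.num r.den], by
    rw [Matrix.det_fin_two_of]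
    have := Int.gcd_eq_gcd_ab r.num r.den
    have h1 : Int.gcd r.num r.den = 1 := by simpa [Int.gcd] using r.reduced
    rw [h1] at this
    push_cast at this
    linarith⟩

/-- `(δ_r)₀₀ = p`, the numerator of `r`. [folklore] -/
@[simp] theorem cuspMatrix_apply_zero_zero (r : ℚ) : cuspMatrix r 0 0 = r.num := rfl

/-- `(δ_r)₁₀ = q`, the denominator of `r`. [folklore] -/
@[simp] theorem cuspMatrix_apply_one_zero (r : ℚ) : cuspMatrix r 1 0 = r.den := rfl

/-- `(δ_r)₁₀ = q ≠ 0`. [folklore] -/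
theorem cuspMatrix_apply_one_zero_ne_zero (r : ℚ) : (cuspMatrix r 1 0 : ℤ) ≠ 0 := by
  rw [cuspMatrix_apply_one_zero]
  exact_mod_cast r.den_nz

/-- `δ_r ∞ = r`: `(δ_r)₀₀ / (δ_r)₁₀ = p/q = r`. [folklore] -/
theorem cuspMatrix_div (r : ℚ) : ((cuspMatrix r 0 0 : ℤ) : ℚ) / ((cuspMatrix r 1 0 : ℤ) : ℚ) = r := by
  simpa using Rat.num_div_den r

end CuspMatrix

/-! ### Discharge of the Manin-calculus named facts of `ModularSymbols` -/

section Discharge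

variable {N : ℕ} [NeZero N] (f : CuspForm (Gamma0 N) 2)

/-- **`t ↦ f(τ + it)` is integrable on `(0, ∞)`** — discharge of the named fact
`integrableOn_eichlerIntegral_integrand` (Cremona 1997, §2.10). [cite: CremonaAlgorithms1997, §2.10] -/
theorem integrableOn_eichlerIntegral_integrand_holds : integrableOn_eichlerIntegral_integrand f :=
  fun τ ↦ (isCuspFunction_one f).integrableOn_ray τ

/-- **`q`-expansion of the Eichler integral**: `2πi ∫_{i∞}^τ f(z) dz = ∑ₙ (aₙ/n) qⁿ`, `q = e^{2πiτ}`
(Cremona 1997, §2.10, (2.10.3); Manin 1972, §1.5). [cite: CremonaAlgorithms1997, §2.10] -/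
theorem hasSum_eichlerIntegral (τ : ℍ) :
    HasSum (fun n : ℕ ↦ cuspCoeff f n / n * Periodic.qParam 1 τ ^ n) (eichlerIntegral f τ) := by
  have H := (isCuspFunction_one f).hasSum_verticalIntegral τ
  have hfun : (fun n : ℕ ↦ (qExpansion 1 ⇑f).coeff n * ((1 : ℝ) / n : ℂ) * Periodic.qParam 1 τ ^ n) =
      fun n : ℕ ↦ cuspCoeff f n / n * Periodic.qParam 1 τ ^ n := by
    funext n
    rw [cuspCoeff, ofReal_one]
    ring
  rwa [hfun] at H

/-- **The Eichler integral is a primitive of `2πi f`**: `d/dz (2πi ∫_{i∞}^z f) = 2πi f(z)` on the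
upper half-plane (Cremona 1997, §2.10). [cite: CremonaAlgorithms1997, §2.10] -/
theorem hasDerivAt_eichlerIntegral {z : ℂ} (hz : 0 < z.im) :
    HasDerivAt (fun w : ℂ ↦ eichlerIntegral f (ofComplex w)) (2 * Real.pi * I * f (ofComplex z)) z :=
  (isCuspFunction_one f).hasDerivAt_verticalIntegral hz

/-- **`t ↦ f(r + it)` is integrable on `(0, ∞)` for every rational cusp `r`** — discharge of the
named fact `integrableOn_modularSymbol_integrand` (`r = δ_r ∞` with `δ_r ∈ SL(2, ℤ)`)
(Manin 1972, §1.5; Cremona 1997, §2.10). [cite: Manin1972, §1.5] -/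
theorem integrableOn_modularSymbol_integrand_holds : integrableOn_modularSymbol_integrand f := by
  intro r
  have := integrableOn_modularSymbol_integrand_smul f (cuspMatrix r)
    (cuspMatrix_apply_one_zero_ne_zero r)
  refine this.congr_fun (fun t _ ↦ ?_) measurableSet_Ioi
  simp [Rat.cast_def]

/-- **`{∞, r + n}_f = {∞, r}_f`** for `n ∈ ℤ` — discharge of the named fact
`modularSymbol_add_intCast`, from `f(z + 1) = f(z)` (Manin 1972, §1.2). [cite: Manin1972, §1.2] -/
theorem modularSymbol_add_intCast_holds : modularSymbol_add_intCast f := by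
  intro r n
  simp only [modularSymbol]
  congr 1
  refine setIntegral_congr_fun measurableSet_Ioi fun t _ ↦ ?_
  have := (isCuspFunction_one f).periodic.int_mul n ((r : ℂ) + t * I)
  simp only [comp_apply] at this
  push_cast
  convert this using 3
  push_cast
  ring

omit [NeZero N] in
/-- For `γ ∈ Γ₀(N)`, `f ∣[2] γ = f`. [folklore] -/
theorem slash_Gamma0 (γ : Gamma0 N) : ⇑f ∣[(2 : ℤ)] (γ : SL(2, ℤ)) = ⇑f := by
  rw [ModularForm.SL_slash]
  exact SlashInvariantForm.slash_action_eqn f _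
    (Subgroup.mem_map_of_mem (Matrix.SpecialLinearGroup.mapGL ℝ) γ.2)

omit [NeZero N] in
/-- An element of `SL(2, ℤ)` with `c = 0` acts as the translation `τ ↦ τ + ab`. [folklore] -/
theorem coe_smul_of_apply_one_zero_eq_zero (g : SL(2, ℤ)) (hc : (g 1 0 : ℤ) = 0) (τ : ℍ) :
    ((g • τ : ℍ) : ℂ) = (τ : ℂ) + ((g 0 0 * g 0 1 : ℤ) : ℂ) := by
  have hdet : (g 0 0 : ℤ) * g 1 1 = 1 := by
    have := Matrix.SpecialLinearGroup.det_coe g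
    rw [Matrix.det_fin_two, hc] at this
    linarith
  have ha : (g 0 0 : ℤ) * g 0 0 = 1 := by
    rcases Int.eq_one_or_neg_one_of_mul_eq_one hdet with h | h <;> simp [h]
  rw [← ofComplex_apply τ, coe_smul_ofComplex g τ.im_pos, moebius, ofComplex_apply, hc]
  have hdC : ((g 0 0 : ℤ) : ℂ) * ((g 1 1 : ℤ) : ℂ) = 1 := by exact_mod_cast hdet
  have haC : ((g 0 0 : ℤ) : ℂ) * ((g 0 0 : ℤ) : ℂ) = 1 := by exact_mod_cast ha
  have hd : ((g 1 1 : ℤ) : ℂ) ≠ 0 := by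
    intro h0
    rw [h0, mul_zero] at hdC
    exact zero_ne_one hdC
  simp only [Int.cast_zero, zero_mul, zero_add]
  rw [div_eq_iff hd]
  push_cast
  linear_combination (-(τ : ℂ) * ((g 0 0 : ℤ) : ℂ) - ((g 0 1 : ℤ) : ℂ)) * hdC +
    (τ : ℂ) * ((g 1 1 : ℤ) : ℂ) * haC

/-- **The Eichler integral transforms by periods** — discharge of the named fact
`eichlerIntegral_smul_sub`: `2πi ∫_{i∞}^{γτ} f - 2πi ∫_{i∞}^{τ} f = {∞, γ∞}_f` for `γ ∈ Γ₀(N)`,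
`τ ∈ ℍ`; in particular the left side is independent of `τ` (Manin 1972, Prop. 1.4;
Cremona 1997, Prop. 2.1.1). [cite: Manin1972, Prop. 1.4] -/
theorem eichlerIntegral_smul_sub_holds : eichlerIntegral_smul_sub f := by
  intro γ τ
  by_cases hc : ((γ : SL(2, ℤ)) 1 0 : ℤ) = 0
  · rw [cuspSymbol, if_pos hc, sub_eq_zero]
    simp only [eichlerIntegral]
    congr 1
    refine setIntegral_congr_fun measurableSet_Ioi fun t _ ↦ ?_
    have := (isCuspFunction_one f).periodic.int_mul ((γ : SL(2, ℤ)) 0 0 * (γ : SL(2, ℤ)) 0 1)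
      ((τ : ℂ) + t * I)
    simp only [comp_apply] at this
    rw [coe_smul_of_apply_one_zero_eq_zero _ hc]
    convert this using 3
    push_cast
    ring
  · rw [cuspSymbol, if_neg hc, modularSymbol_smul_infty f (γ : SL(2, ℤ)) hc τ, slash_Gamma0]
    rfl

/-- **Manin: `γ ↦ {∞, γ∞}_f` is a homomorphism `Γ₀(N) → ℂ`** — discharge of the named fact
`cuspSymbol_mul` (Manin 1972, Prop. 1.4 / Thm. 1.6; Cremona 1997, §2.1). [cite: Manin1972, Prop. 1.4 / Thm. 1.6] -/
theorem cuspSymbol_mul_holds : cuspSymbol_mul f := by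
  intro γ δ
  have H := eichlerIntegral_smul_sub_holds f
  rw [← H (γ * δ) UpperHalfPlane.I, ← H γ ((δ : SL(2, ℤ)) • UpperHalfPlane.I),
    ← H δ UpperHalfPlane.I, Subgroup.coe_mul, mul_smul]
  ring

/-- **The Eichler integral is `Γ₀(N)`-invariant modulo `Λ_f`** — discharge of the named fact
`eichlerIntegral_gamma_smul` (Manin 1972, Prop. 1.4; Cremona 1997, §2.10). [cite: Manin1972, Prop. 1.4] -/
theorem eichlerIntegral_gamma_smul_holds : eichlerIntegral_gamma_smul f := by
  intro γ τ
  rw [eichlerIntegral_smul_sub_holds f γ τ]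
  exact cuspSymbol_mem_periodLattice f γ

/-- **Manin relation `{∞, γr}_f = {∞, γ∞}_f + {∞, r}_f`** for `γ ∈ Γ₀(N)`, `cr + d ≠ 0` —
discharge of the named fact `modularSymbol_gamma0_smul`: with `δ_r ∞ = r`,
`{∞, γδ_r ∞} = V_f(γδ_r τ) - V_{f|δ_r}(τ) = [V_f(γ(δ_r τ)) - V_f(δ_r τ)] + [V_f(δ_r τ) - V_{f|δ_r}(τ)]`
(Manin 1972, Prop. 1.4, Thm. 1.6; Cremona 1997, §2.1–2.2). [cite: Manin1972, Prop. 1.4  Thm. 1.6] -/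
theorem modularSymbol_gamma0_smul_holds : modularSymbol_gamma0_smul f := by
  intro γ r hr
  set δ : SL(2, ℤ) := cuspMatrix r with hδ
  have hq : ((δ 1 0 : ℤ) : ℚ) ≠ 0 := by exact_mod_cast cuspMatrix_apply_one_zero_ne_zero r
  have hr' : ((δ 0 0 : ℤ) : ℚ) / ((δ 1 0 : ℤ) : ℚ) = r := cuspMatrix_div r
  -- entries of `γ δ`
  have h00 : (((γ : SL(2, ℤ)) * δ) 0 0 : ℤ) = (γ : SL(2, ℤ)) 0 0 * δ 0 0 + (γ : SL(2, ℤ)) 0 1 * δ 1 0 := by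
    simp [Matrix.mul_apply, Fin.sum_univ_two]
  have h10 : (((γ : SL(2, ℤ)) * δ) 1 0 : ℤ) = (γ : SL(2, ℤ)) 1 0 * δ 0 0 + (γ : SL(2, ℤ)) 1 1 * δ 1 0 := by
    simp [Matrix.mul_apply, Fin.sum_univ_two]
  have hc : (((γ : SL(2, ℤ)) * δ) 1 0 : ℤ) ≠ 0 := by
    intro h0
    apply hr
    have : ((((γ : SL(2, ℤ)) * δ) 1 0 : ℤ) : ℚ) = 0 := by exact_mod_cast h0
    rw [h10] at this
    push_cast at this
    rw [← hr']
    field_simp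
    linear_combination this
  have key := modularSymbol_smul_infty f ((γ : SL(2, ℤ)) * δ) hc UpperHalfPlane.I
  have hquot : ((((γ : SL(2, ℤ)) * δ) 0 0 : ℤ) : ℚ) / ((((γ : SL(2, ℤ)) * δ) 1 0 : ℤ) : ℚ) =
      (((γ : SL(2, ℤ)) 0 0 : ℚ) * r + ((γ : SL(2, ℤ)) 0 1 : ℚ)) /
        (((γ : SL(2, ℤ)) 1 0 : ℚ) * r + ((γ : SL(2, ℤ)) 1 1 : ℚ)) := by
    rw [h00, h10, ← hr']
    push_cast
    field_simp
  rw [hquot] at key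
  rw [key, SlashAction.slash_mul, slash_Gamma0, mul_smul,
    ← eichlerIntegral_smul_sub_holds f γ (δ • UpperHalfPlane.I), ← hr',
    modularSymbol_smul_infty f δ (cuspMatrix_apply_one_zero_ne_zero r) UpperHalfPlane.I]
  ring

end Discharge

/-! ### Linearity of `{∞, r}_h` and `{∞, γ∞}_h` in the form `h` -/

section Linearity

variable {N : ℕ} [NeZero N]

/-- `{∞, r}` is additive in the cusp form: `{∞, r}_{h₁ + h₂} = {∞, r}_{h₁} + {∞, r}_{h₂}` (both
integrands are integrable, `integrableOn_modularSymbol_integrand_holds`). [folklore] -/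
theorem modularSymbol_add (h₁ h₂ : CuspForm (Gamma0 N) 2) (r : ℚ) :
    modularSymbol (h₁ + h₂) r = modularSymbol h₁ r + modularSymbol h₂ r := by
  simp only [modularSymbol, CuspForm.add_apply]
  rw [integral_add (integrableOn_modularSymbol_integrand_holds h₁ r)
    (integrableOn_modularSymbol_integrand_holds h₂ r), mul_add]

omit [NeZero N] in
/-- `{∞, r}` is homogeneous in the cusp form: `{∞, r}_{c • h} = c {∞, r}_h`. (Refactor note: the
later file `PAdicLFunctionDistributionProofs` carries a copy `modularSymbol_smul` of this lemma with
the identical statement; that copy should be replaced by this one.) [folklore] -/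
theorem modularSymbol_const_smul (c : ℂ) (h : CuspForm (Gamma0 N) 2) (r : ℚ) :
    modularSymbol (c • h) r = c * modularSymbol h r := by
  simp only [modularSymbol, CuspForm.IsGLPos.smul_apply, smul_eq_mul]
  rw [integral_const_mul]
  ring

/-- `{∞, γ∞}` is additive in the cusp form. [folklore] -/
theorem cuspSymbol_add (h₁ h₂ : CuspForm (Gamma0 N) 2) (γ : Gamma0 N) :
    cuspSymbol (h₁ + h₂) γ = cuspSymbol h₁ γ + cuspSymbol h₂ γ := by
  unfold cuspSymbol
  split_ifs with hc
  · simp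
  · exact modularSymbol_add h₁ h₂ _

omit [NeZero N] in
/-- `{∞, γ∞}` is homogeneous in the cusp form. [folklore] -/
theorem cuspSymbol_smul (c : ℂ) (h : CuspForm (Gamma0 N) 2) (γ : Gamma0 N) :
    cuspSymbol (c • h) γ = c * cuspSymbol h γ := by
  unfold cuspSymbol
  split_ifs with hc
  · simp
  · exact modularSymbol_const_smul c h _

end Linearity

end Literature.NumberTheory.EllipticCurves.ModularForms
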